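import Summits.HodgeConjecture.CorCM.PrimeDegreeSlotPairsHodge
import Summits.HodgeConjecture.CorCM.GaloisOcticSimpleCMFourfolds
import Literature.NumberTheory.ComplexMultiplication.CMTypeDictionaryGroupLevel
import HarnessLib

/-!
# A CM field of degree `2p` against any CM field whose GALOIS CLOSURE has degree PRIME TO `p`: nondegenerate iff both
# types are and no imaginary quadratic subfield is shared — a simple CM threefold times a simple CM fourfold whose octic
# field has a Galois closure of `2`-power degree

COR-CM (cell `pub-hodgecm2`, binder seat `b16` gen 46, count-neutral claim PRIME-SLOT, file F7; theorems only, no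
definition, no named fact, no `sorry`).  NEW as stated, hence under `Summits/`.  `CorCM/PrimeDegreeSlotPairsHodge` treats a
slot `a` of degree `2p` (`p` an odd prime) against a slot `b` of degree `< 2p`; the only use of `[K_b : ℚ] < 2p` there is that
an automorphism of `ℂ` acting with order `p` on `Hom(K_a, ℂ) ⊔ Hom(K_b, ℂ)` must FIX `Hom(K_b, ℂ)`.  This holds as soon as NO
automorphism of `ℂ` acts on `Hom(K_b, ℂ)` with order `p` — e.g. when `K_b` embeds in a Galois number field `L` with
`p ∤ [L : ℚ]` (`Aut(ℂ)` acts on `Hom(K_b, ℂ)` through `Gal(L/ℚ)`, the tree's `exists_algEquiv_forall_algHomEquivRingHomOfNormal_smul`):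

* §1 (abstract) `FixingCycle.exists_fixing_cycling_of_prime_of_forall_pow_smul` — `G` transitive on `E_a`, `|E_a| = 2p`,
  `p` an odd prime, and every `g ∈ G` with `gᵖ = 1` on `E_b` trivial on `E_b`: some `c ∈ G` fixes `E_b` and cycles the
  pairs of `E_a`.
* §2 (number fields) `smul_eq_of_pow_smul_eq_of_coprime`; **`forall_smul_eq_of_pow_prime_smul_eq`** — `K ↪ L`, `L/ℚ`
  Galois, `p` coprime to `[L : ℚ]`: an automorphism of `ℂ` with `τᵖ = 1` on `Hom(K, ℂ)` is trivial on `Hom(K, ℂ)`;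
  **`pairwise_of_prime_of_coprime_finrank`** — `[K_a : ℚ] = 2p`, `K_b ↪ L` Galois with `p ∤ [L : ℚ]`, no imaginary quadratic
  subfield of `K_a` embedding in `K_b`: the slots have no common constituent (both orders);
  **`isNondegenerateFamily_iff_of_prime_of_coprime_finrank`** (two slots, any types: nondegenerate ⟺ both nondegenerate ∧ no
  shared imaginary quadratic field) and `hodgeConjectureFor_prod_of_prime_of_coprime_finrank` (realisations).
* §3 THE `(3, 4)` CELL OFF THE `A₄`/`S₄` CLOSURES: **`isNondegenerateFamily_threefold_fourfold_iff_of_coprime`** — `T` a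
  SIMPLE CM abelian threefold (ANY sextic field), `F` a CM abelian fourfold whose octic field embeds in a Galois number
  field of degree prime to `3` (equivalently: the Galois closure of `K_F` is a `2`-group — `K_F` Galois; `K_F⁺` with Galois
  group `V₄`, `C₄` or `D₄`): `Hg(T × F) = Hg(T) × Hg(F)` ⟺ `Φ_F` nondegenerate (`F` not of Weil type) ∧ `K_T`, `K_F` share no
  imaginary quadratic subfield; `hodgeConjectureFor_prod_threefold_fourfold_of_coprime`;
  **`hodgeConjectureFor_prod_threefold_galoisOcticFourfold`** — `K_F` GALOIS octic and `F` SIMPLE (b04: nondegenerate): the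
  Hodge conjecture and `B• = D•` on every `T^a × F^b` iff-lessly, given only «no shared imaginary quadratic field».
  (The complementary `A₄`/`S₄` closures contain the reflex configuration of this seat's gen 45,
  `PairFlipSexticTimesReflexOcticHodge`, where additivity fails on the Hamming balls WITHOUT a shared quadratic field.)

HONEST FRAMING: the Hodge conjecture for NAMED classes of CM abelian varieties; `HC_CM` is neither used nor asserted.

## References

* [Gordon1999HodgeAVSurvey] B. B. Gordon, *A survey of the Hodge conjecture for abelian varieties*, §3 Theorem (Imai,
  Murty), 6.3 Remark, 7.4–7.7, 9.4, 10.10.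
* [MoonenZarhin1999LowDim] B. Moonen, Yu. Zarhin, *Hodge classes on abelian varieties of low dimension*, Math. Ann. 315
  (1999), Thm. (0.2), §3.
* [Shimura1998] G. Shimura, *Abelian Varieties with Complex Multiplication and Modular Functions*, §8.2 Prop. 26, §32.7.
* [Dodson1984] B. Dodson, *The structure of Galois groups of CM-fields*, Trans. AMS 283 (1984), §5.1.1, §5.2 (`n = 4`).
-/

noncomputable section

open CategoryTheory CategoryTheory.Limits NumberField NumberField.ComplexEmbedding Module
open scoped BigOperators

/-! ## §1 Abstract: no element of order `p` on `E_b` -/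

namespace Summit.HodgeConjecture.CorCM.FixingCycle

open Literature.NumberTheory.ComplexMultiplication

variable {G : Type*} [Group G] {I : Type*} {E : I → Type*} [∀ i, MulAction G (E i)] {ρ : G}

/-- **Existence of a fixing–cycling element when no element acts on `E_b` with order `p`.**  `G` transitive on `E_a`,
`|E_a| = 2p` with `p` an odd prime, and every `g` with `gᵖ = 1` on `E_b` trivial on `E_b`: some `c ∈ G` FIXES `E_b`
pointwise and CYCLES THE PAIRS of `E_a` (Cauchy in the image of `G` in `Sym(E_a) × Sym(E_b)`).
[cite: Yanai1985, §3 (p. 170)] [cite: Dodson1984, §5.1.1] -/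
theorem exists_fixing_cycling_of_prime_of_forall_pow_smul {Φ : ∀ i, Set (E i)} (h : ∀ i, IsCMTypeWith ρ (Φ i))
    {a b : I} [Fintype (E a)] [Fintype (E b)] [MulAction.IsPretransitive G (E a)] {p : ℕ} (hp : p.Prime)
    (hp2 : p ≠ 2) (ha : Fintype.card (E a) = 2 * p)
    (hb : ∀ g : G, (∀ y : E b, g ^ p • y = y) → ∀ y : E b, g • y = y) :
    ∃ c : G, (∀ y : E b, c • y = y) ∧ ∀ x x' : E a, ∃ n : ℕ, c ^ n • x = x' ∨ c ^ n • x = ρ • x' := by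
  classical
  haveI : Fact p.Prime := ⟨hp⟩
  obtain ⟨x₀⟩ : Nonempty (E a) := by rw [← Fintype.card_pos_iff, ha]; have := hp.pos; omega
  let θ : G →* Equiv.Perm (E a) × Equiv.Perm (E b) := (MulAction.toPermHom G (E a)).prod (MulAction.toPermHom G (E b))
  have hθ1 : ∀ (g : G) (x : E a), (θ g).1 x = g • x := fun g x => rfl
  have hθ2 : ∀ (g : G) (y : E b), (θ g).2 y = g • y := fun g y => rfl
  letI : MulAction θ.range (E a) :=
    MulAction.compHom (E a) ((MonoidHom.fst (Equiv.Perm (E a)) (Equiv.Perm (E b))).comp θ.range.subtype)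
  have hsmul : ∀ (r : θ.range) (x : E a), r • x = (r : Equiv.Perm (E a) × Equiv.Perm (E b)).1 x := fun _ _ => rfl
  haveI : MulAction.IsPretransitive θ.range (E a) := ⟨fun x y => by
    obtain ⟨g, hg⟩ := MulAction.exists_smul_eq G x y
    exact ⟨⟨θ g, g, rfl⟩, by rw [hsmul]; exact hg⟩⟩
  have hdvd : p ∣ Nat.card θ.range := by
    have h1 := (MulAction.stabilizer θ.range x₀).index_mul_card
    rw [MulAction.index_stabilizer_of_transitive, Nat.card_eq_fintype_card, ha] at h1
    exact Dvd.intro (2 * Nat.card (MulAction.stabilizer θ.range x₀)) (by rw [← h1]; ring)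
  obtain ⟨σ, hσ⟩ := exists_prime_orderOf_dvd_card' p hdvd
  obtain ⟨g, hg⟩ := MonoidHom.mem_range.1 σ.2
  have hord : orderOf (θ g) = p := by rw [hg, Subgroup.orderOf_coe, hσ]
  have hpow : θ (g ^ p) = 1 := by rw [map_pow, ← hord, pow_orderOf_eq_one]
  have hgpa : ∀ x : E a, g ^ p • x = x := fun x => by rw [← hθ1 (g ^ p) x, hpow]; rfl
  have hgpb : ∀ y : E b, g ^ p • y = y := fun y => by rw [← hθ2 (g ^ p) y, hpow]; rfl
  have hfixb : ∀ y : E b, g • y = y := hb g hgpb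
  obtain ⟨x₁, hx₁⟩ : ∃ x₁ : E a, g • x₁ ≠ x₁ := by
    by_contra hall
    push Not at hall
    have h1 : θ g = 1 := by
      refine Prod.ext (Equiv.ext fun x => ?_) (Equiv.ext fun y => ?_)
      · rw [hθ1]; exact hall x
      · rw [hθ2]; exact hfixb y
    rw [h1, orderOf_one] at hord
    exact hp.one_lt.ne hord
  exact ⟨g, hfixb, forall_exists_pow_smul_of_card_eq (h a) hp hp2 hgpa hx₁ ha⟩

end Summit.HodgeConjecture.CorCM.FixingCycle

namespace Summit.HodgeConjecture.CorCM

open Literature.NumberTheory.ComplexMultiplication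
open Literature.AlgebraicGeometry.Motives (AbelianVariety CMType)
open Literature.AlgebraicGeometry.HodgeTheory
open Literature.AlgebraicGeometry.ComplexMultiplication (IsCMTypeRealisation isSimple_iff_isPrimitive)
open Literature.AlgebraicGeometry.VanGeemen1994 (hodgeClassSpan)
open Literature.AlgebraicGeometry.Pohlmann1968
open Literature.Barriers.HodgeConjecture (divisorClassesSpan)

/-! ## §2 Number fields: `Aut(ℂ)` acts on `Hom(K, ℂ)` through a Galois group of order prime to `p` -/

section Coprime

/-- If `gᵖ` and `gⁿ` fix a point and `p`, `n` are coprime, then `g` fixes it. [folklore] -/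
theorem smul_eq_of_pow_smul_eq_of_coprime {M α : Type*} [Monoid M] [MulAction M α] {g : M} {x : α} {p n : ℕ}
    (hc : p.Coprime n) (hp : g ^ p • x = x) (hn : g ^ n • x = x) : g • x = x := by
  have hpow : ∀ (k : ℕ) {q : ℕ}, g ^ q • x = x → g ^ (q * k) • x = x := by
    intro k q hq
    induction k with
    | zero => rw [mul_zero, pow_zero, one_smul]
    | succ k ih => rw [Nat.mul_succ, pow_add, mul_smul, hq, ih]
  rcases Nat.lt_or_ge 1 n with h1 | h1
  · obtain ⟨m, -, hm⟩ := Nat.exists_mul_mod_eq_one_of_coprime hc h1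
    have e : p * m = n * (p * m / n) + 1 := by
      have := Nat.div_add_mod (p * m) n
      rw [hm] at this
      exact this.symm
    have h2 := hpow m hp
    rw [e, pow_succ', mul_smul, hpow _ hn] at h2
    exact h2
  · interval_cases n
    · rw [Nat.coprime_zero_right] at hc
      rw [hc, pow_one] at hp
      exact hp
    · rw [pow_one] at hn
      exact hn

variable {K L : Type} [Field K] [NumberField K] [Field L] [NumberField L] [IsGalois ℚ L]

/-- **An automorphism of `ℂ` acting with `p`-th power trivial on `Hom(K, ℂ)` is trivial there, when `K` embeds in a Galois
number field `L` of degree prime to `p`**: `Aut(ℂ)` acts on `Hom(K, ℂ) ≅ Hom_ℚ(K, L)` through `Gal(L/ℚ)` (Shimura §32.7; the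
tree's `exists_algEquiv_forall_algHomEquivRingHomOfNormal_smul`), whose elements have order dividing `[L : ℚ]`.
[cite: Shimura1998, §32.7] -/
theorem forall_smul_eq_of_pow_prime_smul_eq (j : K →ₐ[ℚ] L) {p : ℕ} (hcop : p.Coprime (finrank ℚ L)) (τ : ℂ ≃+* ℂ)
    (hτ : ∀ y : K →+* ℂ, τ ^ p • y = y) : ∀ y : K →+* ℂ, τ • y = y := by
  obtain ⟨ι⟩ : Nonempty (L →+* ℂ) := inferInstance
  obtain ⟨σ, hσ⟩ := exists_algEquiv_forall_algHomEquivRingHomOfNormal_smul j ι τ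
  set e := algHomEquivRingHomOfNormal j ι with he
  have hiter : ∀ (k : ℕ) (χ : K →ₐ[ℚ] L), e (σ ^ k • χ) = τ ^ k • e χ := by
    intro k
    induction k with
    | zero => intro χ; rw [pow_zero, pow_zero, one_smul, one_smul]
    | succ k ih => intro χ; rw [pow_succ, pow_succ, mul_smul, mul_smul, ih, hσ]
  intro y
  have hn : τ ^ finrank ℚ L • y = y := by
    have h1 := hiter (finrank ℚ L) (e.symm y)
    rw [← IsGalois.card_aut_eq_finrank, pow_card_eq_one', one_smul, Equiv.apply_symm_apply] at h1
    rw [IsGalois.card_aut_eq_finrank] at h1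
    exact h1.symm
  exact smul_eq_of_pow_smul_eq_of_coprime hcop (hτ y) hn

variable {I : Type} {Kf : I → Type} [∀ i, Field (Kf i)] [∀ i, NumberField (Kf i)] [∀ i, IsCMField (Kf i)]

/-- **No common constituent for a prime slot against a slot with Galois closure of degree prime to `p`** (both orders):
`[K_a : ℚ] = 2p` (`p` an odd prime), `K_b ↪ L` with `L/ℚ` Galois and `p ∤ [L : ℚ]`, and no imaginary quadratic subfield of
`K_a` embedding in `K_b`. [cite: Gordon1999HodgeAVSurvey, §3 Theorem (proof) and 6.3 Remark] [cite: Shimura1998, §32.7] -/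
theorem pairwise_of_prime_of_coprime_finrank (Φ : ∀ i, CMType (Kf i)) {a b : I} {p : ℕ} (hp : p.Prime) (hp2 : p ≠ 2)
    (ha : finrank ℚ (Kf a) = 2 * p) (j : Kf b →ₐ[ℚ] L) (hcop : p.Coprime (finrank ℚ L))
    (hno : ¬ ∃ F : IntermediateField ℚ (Kf a), finrank ℚ F = 2 ∧ IsTotallyComplex F ∧ Nonempty (F →+* Kf b)) :
    (∀ P : Submodule ℚ ((Kf a →+* ℂ) → ℚ), P ≤ antiSpan (ℂ ≃+* ℂ) (Φ a).1 →
      (∀ g : ℂ ≃+* ℂ, ∀ f ∈ P, (fun x => f (g • x)) ∈ P) →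
      ∀ T : ((Kf a →+* ℂ) → ℚ) →ₗ[ℚ] ((Kf b →+* ℂ) → ℚ),
        (∀ g : ℂ ≃+* ℂ, ∀ f ∈ P, T (fun x => f (g • x)) = fun y => T f (g • y)) →
        (∀ f ∈ P, T f ∈ antiSpan (ℂ ≃+* ℂ) (Φ b).1) → (∀ f ∈ P, T f = 0 → f = 0) → P = ⊥) ∧
    (∀ P : Submodule ℚ ((Kf b →+* ℂ) → ℚ), P ≤ antiSpan (ℂ ≃+* ℂ) (Φ b).1 →
      (∀ g : ℂ ≃+* ℂ, ∀ f ∈ P, (fun x => f (g • x)) ∈ P) →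
      ∀ T : ((Kf b →+* ℂ) → ℚ) →ₗ[ℚ] ((Kf a →+* ℂ) → ℚ),
        (∀ g : ℂ ≃+* ℂ, ∀ f ∈ P, T (fun x => f (g • x)) = fun y => T f (g • y)) →
        (∀ f ∈ P, T f ∈ antiSpan (ℂ ≃+* ℂ) (Φ a).1) → (∀ f ∈ P, T f = 0 → f = 0) → P = ⊥) := by
  classical
  have hCM : ∀ i, IsCMTypeWith (starRingAut : ℂ ≃+* ℂ) (Φ i).1 := fun i => isCMTypeWith_conj (Φ i)
  haveI : MulAction.IsPretransitive (ℂ ≃+* ℂ) (Kf a →+* ℂ) := isPretransitive_ringEquiv_complex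
  have hca : Fintype.card (Kf a →+* ℂ) = 2 * p := by rw [Embeddings.card, ha]
  obtain ⟨c, hc_b, hc_a⟩ := FixingCycle.exists_fixing_cycling_of_prime_of_forall_pow_smul (G := ℂ ≃+* ℂ)
    (E := fun i => Kf i →+* ℂ) (Φ := fun i => (Φ i).1) hCM (a := a) (b := b) hp hp2 hca
    (fun g hg => forall_smul_eq_of_pow_prime_smul_eq j hcop g hg)
  refine FixingCycle.pairwise_of_fixing_cycling (G := ℂ ≃+* ℂ) (E := fun i => Kf i →+* ℂ) (Φ := fun i => (Φ i).1)
    hCM hc_b hc_a fun χ f f' hf hf' heig heig' hf0 hf'0 => hno ?_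
  exact SignCharacter.exists_quadratic_subfield_ringHom_of_shared_eigen χ heig
    (fun x => apply_rho_smul_of_mem_antiSpan (hCM a) hf x) hf0 heig'
    (fun y => apply_rho_smul_of_mem_antiSpan (hCM b) hf' y) hf'0

variable [Fintype I] [DecidableEq I]

/-- **Two slots, `[K_{i₀} : ℚ] = 2p` against a slot with Galois closure of degree prime to `p`: nondegenerate iff both types
are and no imaginary quadratic field is shared.** [cite: Gordon1999HodgeAVSurvey, §3 Theorem and 7.5–7.7]
[cite: MoonenZarhin1999LowDim, Thm. (0.2)] -/
theorem isNondegenerateFamily_iff_of_prime_of_coprime_finrank {i₀ i₁ : I} (h01 : i₀ ≠ i₁)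
    (hI : ∀ j, j = i₀ ∨ j = i₁) {p : ℕ} (hp : p.Prime) (hp2 : p ≠ 2) (h0 : finrank ℚ (Kf i₀) = 2 * p)
    (j : Kf i₁ →ₐ[ℚ] L) (hcop : p.Coprime (finrank ℚ L)) (Φ : ∀ i, CMType (Kf i)) :
    CMAlgebra.IsNondegenerateFamily Φ ↔ (∀ i, IsNondegenerate (Φ i)) ∧
      ¬ ∃ F : IntermediateField ℚ (Kf i₀), finrank ℚ F = 2 ∧ IsTotallyComplex F ∧ Nonempty (F →+* Kf i₁) := by
  haveI : Nonempty I := ⟨i₀⟩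
  constructor
  · intro hnd
    refine ⟨fun i => hnd.isNondegenerate i, ?_⟩
    rintro ⟨F, hF2, hFtc, ⟨f⟩⟩
    haveI := hFtc
    exact not_isNondegenerateFamily_of_shared_imaginary_quadratic (k := ↥F) hF2 h01 (algebraMap (↥F) (Kf i₀)) f Φ hnd
  · rintro ⟨hnd, hno⟩
    have hab := pairwise_of_prime_of_coprime_finrank Φ hp hp2 h0 j hcop hno
    refine (isNondegenerateFamily_iff_forall_of_pairwise Φ fun i i' hii' => ?_).2 hnd
    rcases hI i with rfl | rfl <;> rcases hI i' with rfl | rfl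
    · exact absurd rfl hii'
    · exact hab.1
    · exact hab.2
    · exact absurd rfl hii'

variable {Φ : ∀ i, CMType (Kf i)} {A : I → AbelianVariety ℂ} {ι : ∀ i, 𝓞 (Kf i) →+* End (A i)}
  {θ : ∀ i, Kf i →+* Module.End ℂ (complexBetti (A i).X 1)}

/-- **The Hodge conjecture on every `A₀^a × A₁^b`** for realisations `A_{i₀}` (SIMPLE, `[K_{i₀} : ℚ] = 2p`, `p` an odd prime)
and `A_{i₁}` (nondegenerate type, field inside a Galois number field of degree prime to `p`) whose fields share no imaginary
quadratic subfield — with `B• = D•`, UNCONDITIONALLY. [cite: Gordon1999HodgeAVSurvey, §3 Theorem, 6.3 Remark and 10.10] -/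
theorem hodgeConjectureFor_prod_of_prime_of_coprime_finrank {i₀ i₁ : I} (h01 : i₀ ≠ i₁) (hI : ∀ j, j = i₀ ∨ j = i₁)
    {p : ℕ} (hp : p.Prime) (hp2 : p ≠ 2) (h0 : finrank ℚ (Kf i₀) = 2 * p) (j : Kf i₁ →ₐ[ℚ] L)
    (hcop : p.Coprime (finrank ℚ L)) (hA : ∀ i, IsCMTypeRealisation (Φ i) (A i) (ι i) (θ i)) (hS₀ : (A i₀).IsSimple)
    (hnd₁ : IsNondegenerate (Φ i₁))
    (hno : ¬ ∃ F : IntermediateField ℚ (Kf i₀), finrank ℚ F = 2 ∧ IsTotallyComplex F ∧ Nonempty (F →+* Kf i₁))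
    {N : ℕ} (π : Fin N → I) :
    HodgeConjectureFor (⨁ fun j : Fin N => A (π j)).dim (⨁ fun j : Fin N => A (π j)).X ∧
      ∀ m : ℕ, hodgeClassSpan (⨁ fun j : Fin N => A (π j)).dim (⨁ fun j : Fin N => A (π j)).X m =
        divisorClassesSpan (⨁ fun j : Fin N => A (π j)).X (⨁ fun j : Fin N => A (π j)).dim m := by
  haveI : Nonempty I := ⟨i₀⟩
  obtain ⟨φ₀⟩ : Nonempty (Kf i₀ →+* ℂ) := inferInstance
  have hnd₀ : IsNondegenerate (Φ i₀) :=
    isNondegenerate_of_isPrimitive_of_prime hp h0 φ₀ ((isSimple_iff_isPrimitive (hA i₀) φ₀).1 hS₀)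
  have hnd : ∀ i, IsNondegenerate (Φ i) := fun i => by
    rcases hI i with rfl | rfl
    · exact hnd₀
    · exact hnd₁
  have h := (isNondegenerateFamily_iff_of_prime_of_coprime_finrank h01 hI hp hp2 h0 j hcop Φ).2 ⟨hnd, hno⟩
  exact ⟨h.hodgeConjectureFor_prod hA π, fun m => h.hodgeClassSpan_prod_eq_divisorClassesSpan hA π m⟩

end Coprime

/-! ## §3 The `(3, 4)` cell off the `A₄`/`S₄` closures -/

section ThreeFour

variable {L : Type} [Field L] [NumberField L] [IsGalois ℚ L]
variable {I : Type} {K : I → Type} [∀ i, Field (K i)] [∀ i, NumberField (K i)] [∀ i, IsCMField (K i)] [Fintype I]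
  [DecidableEq I] {Φ : ∀ i, CMType (K i)}
variable {A : I → AbelianVariety ℂ} {ι : ∀ i, 𝓞 (K i) →+* End (A i)}
  {θ : ∀ i, K i →+* Module.End ℂ (complexBetti (A i).X 1)}

/-- **A simple CM abelian THREEFOLD times a CM abelian FOURFOLD whose octic field lies in a Galois number field of degree
prime to `3`** (`K_F` Galois; `K_F⁺` with Galois group `V₄`, `C₄`, `D₄`; NOT the `A₄`/`S₄` closures): `Hg(T × F) = Hg(T) ×
Hg(F)` iff `Φ_F` is nondegenerate (`F` not of Weil type) and the sextic and octic fields share no imaginary quadratic subfield.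
[cite: MoonenZarhin1999LowDim, Thm. (0.2) and §3] [cite: Dodson1984, §5.2] [cite: Gordon1999HodgeAVSurvey, §3 Theorem and 7.5–7.7] -/
theorem isNondegenerateFamily_threefold_fourfold_iff_of_coprime {i₀ i₁ : I} (h01 : i₀ ≠ i₁) (hI : ∀ j, j = i₀ ∨ j = i₁)
    (hA : ∀ i, IsCMTypeRealisation (Φ i) (A i) (ι i) (θ i)) (hd₀ : (A i₀).dim = 3) (hS₀ : (A i₀).IsSimple)
    (j : K i₁ →ₐ[ℚ] L) (hcop : (3 : ℕ).Coprime (finrank ℚ L)) :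
    CMAlgebra.IsNondegenerateFamily Φ ↔ IsNondegenerate (Φ i₁) ∧
      ¬ ∃ F : IntermediateField ℚ (K i₀), finrank ℚ F = 2 ∧ IsTotallyComplex F ∧ Nonempty (F →+* K i₁) := by
  obtain ⟨φ₀⟩ : Nonempty (K i₀ →+* ℂ) := inferInstance
  have h0 : finrank ℚ (K i₀) = 2 * 3 := by rw [finrank_eq_two_mul_dim_of_isCMTypeRealisation (hA i₀), hd₀]
  have hnd₀ : IsNondegenerate (Φ i₀) :=
    isNondegenerate_of_isPrimitive_of_prime Nat.prime_three h0 φ₀ ((isSimple_iff_isPrimitive (hA i₀) φ₀).1 hS₀)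
  rw [isNondegenerateFamily_iff_of_prime_of_coprime_finrank h01 hI Nat.prime_three (by norm_num) h0 j hcop Φ]
  refine ⟨fun H => ⟨H.1 i₁, H.2⟩, fun H => ⟨fun i => ?_, H.2⟩⟩
  rcases hI i with rfl | rfl
  · exact hnd₀
  · exact H.1

/-- **The Hodge conjecture on every `T^a × F^b`** — `T` a simple CM threefold, `F` a realisation of a NONDEGENERATE type of an
octic CM field inside a Galois number field of degree prime to `3`, the fields sharing no imaginary quadratic subfield — with
`B• = D•`, UNCONDITIONALLY. [cite: Gordon1999HodgeAVSurvey, §3 Theorem and 10.10] [cite: MoonenZarhin1999LowDim, Thm. (0.2)] -/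
theorem hodgeConjectureFor_prod_threefold_fourfold_of_coprime {i₀ i₁ : I} (h01 : i₀ ≠ i₁) (hI : ∀ j, j = i₀ ∨ j = i₁)
    (hA : ∀ i, IsCMTypeRealisation (Φ i) (A i) (ι i) (θ i)) (hd₀ : (A i₀).dim = 3) (hS₀ : (A i₀).IsSimple)
    (j : K i₁ →ₐ[ℚ] L) (hcop : (3 : ℕ).Coprime (finrank ℚ L)) (hnd₁ : IsNondegenerate (Φ i₁))
    (hno : ¬ ∃ F : IntermediateField ℚ (K i₀), finrank ℚ F = 2 ∧ IsTotallyComplex F ∧ Nonempty (F →+* K i₁))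
    {N : ℕ} (π : Fin N → I) :
    HodgeConjectureFor (⨁ fun j : Fin N => A (π j)).dim (⨁ fun j : Fin N => A (π j)).X ∧
      ∀ m : ℕ, hodgeClassSpan (⨁ fun j : Fin N => A (π j)).dim (⨁ fun j : Fin N => A (π j)).X m =
        divisorClassesSpan (⨁ fun j : Fin N => A (π j)).X (⨁ fun j : Fin N => A (π j)).dim m := by
  haveI : Nonempty I := ⟨i₀⟩
  have h := (isNondegenerateFamily_threefold_fourfold_iff_of_coprime h01 hI hA hd₀ hS₀ j hcop).2 ⟨hnd₁, hno⟩
  exact ⟨h.hodgeConjectureFor_prod hA π, fun m => h.hodgeClassSpan_prod_eq_divisorClassesSpan hA π m⟩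

/-- **Every simple CM abelian threefold times every SIMPLE CM abelian fourfold with GALOIS octic CM field: the Hodge
conjecture and `B• = D•` on every `T^a × F^b`, as soon as the sextic and the octic field share no imaginary quadratic
subfield** — UNCONDITIONALLY.  (`[K_F : ℚ] = 8` is prime to `3`; a simple CM fourfold with Galois CM field is nondegenerate
by seat b04's `GaloisOctic.isNondegenerate_of_isPrimitive_of_isGalois_eight`.) [cite: Gordon1999HodgeAVSurvey, §3 Theorem and 10.10]
[cite: Dodson1984, §3.3.2 Theorem and §5.2] -/
theorem hodgeConjectureFor_prod_threefold_galoisOcticFourfold {i₀ i₁ : I} (h01 : i₀ ≠ i₁) (hI : ∀ j, j = i₀ ∨ j = i₁)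
    [IsGalois ℚ (K i₁)] (hA : ∀ i, IsCMTypeRealisation (Φ i) (A i) (ι i) (θ i)) (hd₀ : (A i₀).dim = 3)
    (hd₁ : (A i₁).dim = 4) (hS : ∀ i, (A i).IsSimple)
    (hno : ¬ ∃ F : IntermediateField ℚ (K i₀), finrank ℚ F = 2 ∧ IsTotallyComplex F ∧ Nonempty (F →+* K i₁))
    {N : ℕ} (π : Fin N → I) :
    HodgeConjectureFor (⨁ fun j : Fin N => A (π j)).dim (⨁ fun j : Fin N => A (π j)).X ∧
      ∀ m : ℕ, hodgeClassSpan (⨁ fun j : Fin N => A (π j)).dim (⨁ fun j : Fin N => A (π j)).X m =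
        divisorClassesSpan (⨁ fun j : Fin N => A (π j)).X (⨁ fun j : Fin N => A (π j)).dim m := by
  obtain ⟨φ₁⟩ : Nonempty (K i₁ →+* ℂ) := inferInstance
  have h8 : finrank ℚ (K i₁) = 8 := by rw [finrank_eq_two_mul_dim_of_isCMTypeRealisation (hA i₁), hd₁]
  have hnd₁ : IsNondegenerate (Φ i₁) :=
    GaloisOctic.isNondegenerate_of_isPrimitive_of_isGalois_eight h8 φ₁ ((isSimple_iff_isPrimitive (hA i₁) φ₁).1 (hS i₁))
  exact hodgeConjectureFor_prod_threefold_fourfold_of_coprime h01 hI hA hd₀ (hS i₀) (AlgHom.id ℚ (K i₁))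
    (by rw [h8]; norm_num) hnd₁ hno π

/-- … and the sharp form: for `T` a simple CM threefold and `F` a simple CM fourfold with Galois octic field (not
isogenous — automatic), `B• = D•` on EVERY `T^a × F^b` iff the fields share no imaginary quadratic subfield.
[cite: Gordon1999HodgeAVSurvey, 7.5–7.7 and 9.4] [cite: Dodson1984, §3.3.2 Theorem] -/
theorem forall_prod_hodgeClassSpan_eq_iff_threefold_galoisOcticFourfold {i₀ i₁ : I} (h01 : i₀ ≠ i₁)
    (hI : ∀ j, j = i₀ ∨ j = i₁) [IsGalois ℚ (K i₁)] (hA : ∀ i, IsCMTypeRealisation (Φ i) (A i) (ι i) (θ i))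
    (hd₀ : (A i₀).dim = 3) (hd₁ : (A i₁).dim = 4) (hS : ∀ i, (A i).IsSimple)
    (hniso : ∀ i j, i ≠ j → ¬ AbelianVariety.IsIsogenous (A i) (A j)) :
    (∀ (N : ℕ) (π : Fin N → I) (m : ℕ),
        hodgeClassSpan (⨁ fun j : Fin N => A (π j)).dim (⨁ fun j : Fin N => A (π j)).X m =
          divisorClassesSpan (⨁ fun j : Fin N => A (π j)).X (⨁ fun j : Fin N => A (π j)).dim m) ↔
      ¬ ∃ F : IntermediateField ℚ (K i₀), finrank ℚ F = 2 ∧ IsTotallyComplex F ∧ Nonempty (F →+* K i₁) := by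
  haveI : Nonempty I := ⟨i₀⟩
  obtain ⟨φ₁⟩ : Nonempty (K i₁ →+* ℂ) := inferInstance
  have h8 : finrank ℚ (K i₁) = 8 := by rw [finrank_eq_two_mul_dim_of_isCMTypeRealisation (hA i₁), hd₁]
  have hnd₁ : IsNondegenerate (Φ i₁) :=
    GaloisOctic.isNondegenerate_of_isPrimitive_of_isGalois_eight h8 φ₁ ((isSimple_iff_isPrimitive (hA i₁) φ₁).1 (hS i₁))
  rw [← CMAlgebra.isNondegenerateFamily_iff_forall_prod_hodgeClassSpan_eq
      (CMAlgebra.isSeparatingFamily_of_isSimple_of_pairwise_not_isIsogenous hA hS hniso) hA,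
    isNondegenerateFamily_threefold_fourfold_iff_of_coprime h01 hI hA hd₀ (hS i₀) (AlgHom.id ℚ (K i₁))
      (by rw [h8]; norm_num)]
  exact ⟨fun H => H.2, fun H => ⟨hnd₁, H⟩⟩

end ThreeFour

end Summit.HodgeConjecture.CorCM

end
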